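import Summits.FinalStateConjecture.FinalStateConjecture.Theses.CurvatureOrSymmetry
import Literature.Geometry.Lorentzian.Extension
import Literature.Geometry.Lorentzian.VisibleIncompleteNullRay
import Literature.Geometry.Lorentzian.PPCurvatureSingularity
import Literature.Geometry.Lorentzian.KillingHorizonShadowAlong
import HarnessLib.Audit

/-!
# Birth skeleton (BC3) — crux `NoFourthExit` (stmt-FinalStateConjecture-10210), route `CurvatureOrSymmetry`

`Cruxes/NoFourthExit/Lines/birth.lean` · registrar planner-skel-stmt-FinalStateConjecture-10210-0 · 2026-08-17 ·
mode skeleton-register (route re-audit bin REPAIRABLE).  The crux is FIXED and is concluded BY NAME: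

  `Summit.FinalStateConjecture.FinalStateConjecture.Theses.CurvatureOrSymmetry.NoFourthExit`

(rank 2, "censorship fails only by curvature or by symmetry", ALL admissible data, no genericity): every
maximal vacuum Cauchy development `𝒟` of an admissible datum whose future null infinity is incomplete
(sojourn form) contains a VISIBLE future-incomplete null ray `γ` which ends EITHER (a) BY CURVATURE — a
parallel family along `γ` with unbounded curvature components — OR (c) BY SYMMETRY — a Killing field near the
tail, `g(K, γ') = -1`, null at the end (a Killing-horizon shadow).

## The cut — three named stubs along the classical trichotomy of boundary points

An incomplete curve ends (Ellis–Schmidt, GRG 8 (1977); Hawking–Ellis 1973 §8.1, §8.3) at a p.p. CURVATURE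
singularity, at a QUASI-REGULAR singularity, or at a REGULAR boundary point (the spacetime extends through it).
"No fourth exit" = for MGHDs of admissible vacuum data seen from infinity, bounded curvature forces a regular
exit (no quasi-regular / rough visible ends) AND a regular exit of the MAXIMAL development is the shadow of a
Killing horizon.  The one new object is therefore the REGULAR EXIT (`ExitsRegularly 𝒟 γ dom`: `ι ∘ γ`
converges to a point outside `ι(M)` in a smooth Sbierski extension `(M', ι)` of the bundled Lorentzian
manifold of `𝒟`, `LorentzianManifold.IsExtension` of `Extension.lean`), and the stubs are:

* `stub_visibleIncompleteRay` (L) — BY NAME the route's support item `VisibleIncompleteRay`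
  (stmt-FinalStateConjecture-10213): incomplete `𝓘⁺` ⇒ a visible future-incomplete null ray exists
  (sojourn negation, landed as `Theorems.exists_normalisedNullRay_of_not_hasCompleteNullInfinity`, plus
  asymptotically flat exterior stability: Klainerman–Nicolò 2003, Shen arXiv:2211.15230).
* `stub_regularExitOfBoundedCurvature` (XL) — if an MGHD of admissible data has a visible incomplete ray and
  NO visible incomplete ray ends by curvature, SOME visible incomplete ray exits regularly (Clarke's local
  extension, CMP 32 (1973) / CMP 84 (1982), globalised along a non-imprisoned ray; the free choice of the ray
  gives Clarke's tube of bounded-curvature rays; the vacuum equations supply the regularity upgrade —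
  the informal child `ScaleCriticalUpgrade`, stmt-10222, lives here).
* `stub_symmetryOfRegularExit` (XL, hardest) — a visible incomplete ray of a MAXIMAL development that exits
  regularly ends by symmetry: the exit point lies on the Cauchy horizon of the data inside `M'`, and vacuum
  Cauchy horizons are Killing horizons (Moncrief–Isenberg 1983; Friedrich–Rácz–Wald gr-qc/9811021;
  Petersen–Rácz arXiv:1809.02580; Bustamante–Reiris arXiv:2008.11926), read back along `γ` as the shadow (c).

`NoFourthExit_of : Sig.stub_visibleIncompleteRay → Sig.stub_regularExitOfBoundedCurvature →
Sig.stub_symmetryOfRegularExit → NoFourthExit` is PROVED (§3, classical case split on "some visible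
incomplete ray ends by curvature"; every hand-over definitional: `VisibleRay` / `EndsByCurvature` /
`EndsBySymmetry` are token-identical copies of the crux's three inlined predicates and agree by `Iff.rfl` with
the Literature packages `DataEmbedding.IsVisibleIncompleteNullRay`, `PPCurvatureBlowupAlong (Fin 4) · · 0`,
`KillingHorizonShadowAlong`, §0).  `lean check`: sorries ONLY in the three `stub_*`.

Hardest stub: `stub_symmetryOfRegularExit` (no rigidity theorem covers a non-compact, possibly degenerate
horizon through one visible point).  The two XL stubs are exactly the two clauses of the crux's recorded
why-might-fail ("bounded p.p. curvature on visible rays gives no `C²` extension — Clarke needs Hölder control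
in a tube"; "Killing rigidity is proved only for whole compact `κ ≠ 0` horizons"), now separated by a typed
object, so that each can be attacked, transferred or refuted on its own: a `¬ stub_regularExitOfBoundedCurvature`
(a visible quasi-regular or rough end of an MGHD of admissible data) or a `¬ stub_symmetryOfRegularExit`
(a non-Killing smooth Cauchy horizon through a visible point) would each name a FOURTH EXIT and most likely
kill the crux itself — informative either way.

BC3 probes (registrar, 2026-08-17, files `bc/probe_*.lean` of the registrar's folder): for each of the three
stub signatures `S`, `example : S → NoFourthExit` and `example : S → FinalStateConjecture` by
`first | exact? | simpa | aesop` FAIL (no stub is cheaply the crux or the summit).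

Disproof used: none exists for this crux (`ledger crux ls stmt-FinalStateConjecture-10210`: no workfiles; no
`disproof_path` in the payload; no `Theorems/NoFourthExit/Negative/*`, 2026-08-17).  Negatives index: no
refuted statement of the summit concerns visible incomplete rays, p.p. blow-up or Killing shadows.  The
refuter's typing note on the crux (g41-18: "(c) is satisfiable cheaply wherever a null Killing field exists
near the tail") is honoured: (c) is used exactly as typed, and stub 3 is the only place it is produced.
-/

noncomputable section

-- every `Summit.FinalStateConjecture.FinalStateConjecture.…` name repeats the summit = sub-problem segment
-- (D-0017 layout); the duplicate is deliberate.
set_option linter.dupNamespace false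
set_option linter.unusedVariables false

namespace Summit.FinalStateConjecture.FinalStateConjecture.Cruxes.NoFourthExit.Birth

open scoped Manifold ContDiff Topology
open Filter Set Literature.Geometry.Lorentzian
open Summit.FinalStateConjecture.FinalStateConjecture.Theses.CurvatureOrSymmetry (NoFourthExit VisibleIncompleteRay)

/-! ## §0 Read-back vocabulary — the three predicates inlined in the crux, verbatim, and the one new object -/

section Vocabulary

variable {X : Type} [TopologicalSpace X] [ChartedSpace E3 X] [IsManifold (𝓡 3) ∞ X] [ConnectedSpace X]
  {D : InitialDataSet (𝓡 3) X}

/-- `(γ, dom)` is a **visible future-incomplete null ray** of the vacuum Cauchy development `𝒟`: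
verbatim the first conjunct of the `∃ (γ, dom)`-body of the crux `NoFourthExit` (maximal geodesic of the
Levi-Civita connection on `dom ∋ 0`, `dom` bounded above, null future-directed velocity, and every `γ t`,
`t ≥ 0`, in the chronological past of the nonnegative half of a future-COMPLETE normalised null ray from the
data hypersurface).  It is `𝒟.toDataEmbedding.IsVisibleIncompleteNullRay γ dom` of
`Literature/Geometry/Lorentzian/VisibleIncompleteNullRay.lean` by `Iff.rfl` (checked below) and, under the
crux's binders, the body of the route's support item `VisibleIncompleteRay` (stmt-FinalStateConjecture-10213).
Hawking–Ellis 1973, §8.1 (pp. 257–258), §9.2 (p. 311: "naked, i.e. visible from `𝓘⁺`"). -/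
def VisibleRay (𝒟 : VacuumCauchyDevelopment D) [𝒟.metric.HasLeviCivita] (γ : ℝ → 𝒟.carrier)
    (dom : Set ℝ) : Prop :=
  (Literature.Geometry.Lorentzian.IsMaximalGeodesicOn 𝒟.metric.leviCivita γ dom ∧ (0 : ℝ) ∈ dom ∧
    BddAbove dom ∧ (∀ t ∈ dom, 𝒟.metric.IsNull (Literature.Geometry.Lorentzian.velocity (𝓡 4) γ t) ∧
    𝒟.timeOrientation.IsFutureDirected (Literature.Geometry.Lorentzian.velocity (𝓡 4) γ t)) ∧ (∀ t ∈
    dom, 0 ≤ t → (∃ (p : X) (δ : ℝ → 𝒟.carrier) (s : Set ℝ), 𝒟.metric.IsNormalisedNullRayFrom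
    𝒟.timeOrientation 𝒟.embed 𝒟.normal p δ s ∧ ¬ BddAbove s ∧ γ t ∈ 𝒟.metric.chronologicalPast
    𝒟.timeOrientation (δ '' (s ∩ Set.Ici 0)))))

/-- **Alternative (a) of the crux — `γ` ENDS BY CURVATURE**: verbatim the left disjunct of `NoFourthExit`
(some family `e : Fin 4 → (vector fields along γ)`, parallel on `dom` and linearly independent at `0`, has
curvature components `g(R(e_a,e_b)e_c,e_d)(γ t)` unbounded on `t ≥ 0` — a p.p. curvature singularity,
Hawking–Ellis 1973, §8.1, p. 260).  It is
`𝒟.metric.toPseudoRiemannianMetric.PPCurvatureBlowupAlong (Fin 4) γ dom 0` of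
`Literature/Geometry/Lorentzian/PPCurvatureSingularity.lean` by `Iff.rfl` (checked below). -/
def EndsByCurvature (𝒟 : VacuumCauchyDevelopment D) [𝒟.metric.HasLeviCivita] (γ : ℝ → 𝒟.carrier)
    (dom : Set ℝ) : Prop :=
  (∃ e : Fin 4 → (Π t : ℝ, TangentSpace (𝓡 4) (γ t)), (∀ a, ∀ t ∈ dom, MDifferentiableAt 𝓘(ℝ, ℝ)
    (𝓡 4).tangent (fun s : ℝ ↦ (Bundle.TotalSpace.mk' Literature.Geometry.Lorentzian.E4 (γ s) (e a
    s) : TangentBundle (𝓡 4) 𝒟.carrier)) t ∧ Literature.Geometry.Lorentzian.covariantDerivAlong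
    𝒟.metric.leviCivita γ (e a) t = 0) ∧ LinearIndependent ℝ (fun a ↦ e a 0) ∧ ∀ C : ℝ, ∃ t ∈ dom, 0
    ≤ t ∧ ∃ a b c d : Fin 4, C < |𝒟.metric.val (γ t) (CovariantDerivative.curvature
    𝒟.metric.leviCivita (γ t) (e a t) (e b t) (e c t)) (e d t)|)

/-- **Alternative (c) of the crux — `γ` ENDS BY SYMMETRY (Killing-horizon shadow)**: verbatim the right
disjunct of `NoFourthExit` (an open `U` containing a tail `γ([t₀, sup dom))`, a vector field `K` smooth on
`U` satisfying the Killing equation on `U`, normalised `g(K(γ t), γ' t) = -1` on the tail, with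
`g(K, K)(γ t) → 0` as `t → sSup dom` within `dom`).  It is
`𝒟.metric.toPseudoRiemannianMetric.KillingHorizonShadowAlong γ dom` of
`Literature/Geometry/Lorentzian/KillingHorizonShadowAlong.lean` by `Iff.rfl` (checked below).  Models:
Misner / Taub–NUT (Hawking–Ellis 1973, §5.8), the Kerr Cauchy horizon; Moncrief–Isenberg, CMP 89 (1983). -/
def EndsBySymmetry (𝒟 : VacuumCauchyDevelopment D) [𝒟.metric.HasLeviCivita] (γ : ℝ → 𝒟.carrier)
    (dom : Set ℝ) : Prop :=
  (∃ (U : Set 𝒟.carrier) (K : Π x : 𝒟.carrier, TangentSpace (𝓡 4) x) (t₀ : ℝ), IsOpen U ∧ t₀ ∈ dom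
    ∧ (∀ t ∈ dom, t₀ ≤ t → γ t ∈ U) ∧ ContMDiffOn (𝓡 4) ((𝓡 4).prod 𝓘(ℝ,
    Literature.Geometry.Lorentzian.E4)) ((⊤ : ℕ∞) : WithTop ℕ∞) (fun x ↦ (Bundle.TotalSpace.mk'
    Literature.Geometry.Lorentzian.E4 x (K x) : TangentBundle (𝓡 4) 𝒟.carrier)) U ∧ (∀ x ∈ U, ∀ v w
    : TangentSpace (𝓡 4) x, 𝒟.metric.val x (𝒟.metric.leviCivita K x v) w + 𝒟.metric.val x v
    (𝒟.metric.leviCivita K x w) = 0) ∧ (∀ t ∈ dom, t₀ ≤ t → 𝒟.metric.val (γ t) (K (γ t))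
    (Literature.Geometry.Lorentzian.velocity (𝓡 4) γ t) = -1) ∧ Filter.Tendsto (fun t : ℝ ↦
    𝒟.metric.val (γ t) (K (γ t)) (K (γ t))) (nhdsWithin (sSup dom) dom) (nhds 0))

/-- **The new intermediate object — `γ` EXITS REGULARLY (it ends at a regular boundary point of the MGHD).**
There are a SMOOTH Lorentzian `4`-manifold `M'`, a map `ι : M → M'` which is an extension of the bundled
Lorentzian manifold of `𝒟` in Sbierski's sense (`LorentzianManifold.IsExtension`, `Extension.lean`:
`ι` smooth, an open topological embedding, isometric `ι^* g' = g`, `ι(M) ≠ M'`), and a point `p' ∈ M'`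
OUTSIDE `ι(M)` to which `ι ∘ γ` converges as `t → sSup dom` within `dom`: the future ideal endpoint of the
incomplete geodesic `γ` is a `C^∞`-regular boundary point (Ellis–Schmidt, GRG 8 (1977) 915, §2; Clarke, CMP 32
(1973) 205 and CMP 84 (1982) 329: local extendibility; Hawking–Ellis 1973, §8.1, §8.3).  For a maximal
(inextendible) geodesic with `dom` bounded above the clause `p' ∉ range ι` is automatic (a geodesic that
converges in `M` at a finite parameter end extends, by convex normal neighbourhoods; O'Neill 1983, Ch. 5,
Prop. 7 ff.) — it is recorded so that consumers need not re-derive it.  Nothing is asked of `M'` beyond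
`ι(M)`: no field equation, no time orientation; the boundary `∂ι(M)` near `p'` is where stub 3 must find the
trace of a Killing horizon.  (Extension in the universe of the carrier, as in `LorentzianManifold.IsExtendible`.) -/
def ExitsRegularly (𝒟 : VacuumCauchyDevelopment D) (γ : ℝ → 𝒟.carrier) (dom : Set ℝ) : Prop :=
  ∃ (M' : LorentzianManifold.{0} 4 ∞) (ι : 𝒟.carrier → M'.carrier) (p' : M'.carrier),
    LorentzianManifold.IsExtension 𝒟.toLorentzianManifold M' ι ∧ p' ∉ Set.range ι ∧
      Tendsto (ι ∘ γ) (𝓝[dom] (sSup dom)) (𝓝 p')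

/-! ### Consistency with the Literature vocabulary (definitional, `Iff.rfl`) -/

example (𝒟 : VacuumCauchyDevelopment D) [𝒟.metric.HasLeviCivita] (γ : ℝ → 𝒟.carrier) (dom : Set ℝ) :
    VisibleRay 𝒟 γ dom ↔ 𝒟.toDataEmbedding.IsVisibleIncompleteNullRay γ dom :=
  Iff.rfl

example (𝒟 : VacuumCauchyDevelopment D) [𝒟.metric.HasLeviCivita] (γ : ℝ → 𝒟.carrier) (dom : Set ℝ) :
    EndsByCurvature 𝒟 γ dom ↔ 𝒟.metric.toPseudoRiemannianMetric.PPCurvatureBlowupAlong (Fin 4) γ dom 0 :=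
  Iff.rfl

example (𝒟 : VacuumCauchyDevelopment D) [𝒟.metric.HasLeviCivita] (γ : ℝ → 𝒟.carrier) (dom : Set ℝ) :
    EndsBySymmetry 𝒟 γ dom ↔ 𝒟.metric.toPseudoRiemannianMetric.KillingHorizonShadowAlong γ dom :=
  Iff.rfl

end Vocabulary

/-! ## §1 The stub SIGNATURES (`Sig.stub_<name>`; the skeleton audit reads the hypotheses of `NoFourthExit_of`
BY NAME, heads = stub names) -/

/-- **STUB 2 — REGULAR EXIT OF BOUNDED CURVATURE** (Clarke-type local extension made global, fed by a vacuum
regularity bootstrap; the "not by curvature ⇒ regular" half of "censorship fails only by curvature or by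
symmetry").  For every admissible datum `D` and every maximal vacuum Cauchy development `𝒟` of `D` which HAS a
visible future-incomplete null ray, if NO visible future-incomplete null ray of `𝒟` ends by curvature (every
parallel family along every such ray has bounded curvature components), then SOME visible future-incomplete
null ray of `𝒟` exits regularly (`ExitsRegularly`: it converges to a boundary point of `M` inside a smooth
extension `(M', ι)`).  The ray is the statement's to choose (the crux only asks for one ray), so the bounds
are available along all visible incomplete rays near the chosen one — Clarke's tube hypothesis — and the
Einstein vacuum equations are available to upgrade bounded curvature to one-sided smoothness.
Why it might fail: bounded p.p. curvature along rays gives at best a `C^{2-}` local extension (Clarke needs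
Hölder control of `R` and its derivatives in a tube), and quasi-regular (cone-like) visible ends — bounded
curvature, no extension at all — are not excluded by anything known for vacuum; either would be a genuine
fourth exit.  Sources: Clarke, CMP 32 (1973) 205 (doi:10.1007/BF01645592) and CMP 84 (1982) 329
(doi:10.1007/BF01208481); Ellis–Schmidt, GRG 8 (1977) 915 (doi:10.1007/BF00759240); Hawking–Ellis 1973 §8.1,
§8.3, §8.5; Rácz, arXiv:gr-qc/9401015 context; Klainerman–Rodnianski–Szeftel, arXiv:1204.1767 (bounded `L²`
curvature continuation).  Size: XL / open. -/
def Sig.stub_regularExitOfBoundedCurvature : Prop :=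
  ∀ (X : Type) [TopologicalSpace X] [ChartedSpace E3 X] [IsManifold (𝓡 3) ∞ X] [T2Space X]
    [SecondCountableTopology X] [ConnectedSpace X], ∀ D ∈ admissibleVacuumData X, ∀ 𝒟 :
    VacuumCauchyDevelopment D, 𝒟.IsMaximal → ∀ [𝒟.metric.HasLeviCivita], (∃ (γ : ℝ → 𝒟.carrier) (dom
    : Set ℝ), VisibleRay 𝒟 γ dom) → (∀ (γ : ℝ → 𝒟.carrier) (dom : Set ℝ), VisibleRay 𝒟 γ dom → ¬
    EndsByCurvature 𝒟 γ dom) → ∃ (γ : ℝ → 𝒟.carrier) (dom : Set ℝ), VisibleRay 𝒟 γ dom ∧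
    ExitsRegularly 𝒟 γ dom

/-- **STUB 3 — SYMMETRY OF REGULAR EXITS** (Cauchy-horizon rigidity, localised to one visible regular exit;
the "regular ⇒ by symmetry" half).  For every admissible datum `D`, every MAXIMAL vacuum Cauchy development `𝒟`
of `D` and every visible future-incomplete null ray `(γ, dom)` of `𝒟` which exits regularly, `γ` ends by
symmetry: near its tail there is a Killing field `K` of `g` with `g(K, γ') = -1` becoming null at the end
(`EndsBySymmetry`).  Mechanism: since `𝒟` is the MGHD (and stays smooth as long as it stays `C²`,
continuation principle), the boundary `∂ι(M) ∋ p'` of a regular exit is a piece of the future CAUCHY HORIZON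
of the data inside `M'`; the bet is the Moncrief–Isenberg phenomenon — vacuum Cauchy horizons are Killing
horizons — for this non-compact, asymptotically flat, one-ended setting, read back inside `M` along `γ` as the
shadow (c) (`KillingHorizonShadowAlong.of_isGeodesicOn_of_ne_zero` normalises any conserved `g(K, γ') ≠ 0`).
Maximality is load-bearing (a development truncated at a generic spacelike cut exits regularly everywhere with
no Killing field) and is the hypothesis every use of this stub must cite.
Why it might fail: Killing rigidity of Cauchy horizons is proved only for COMPACT horizons with closed or
non-degenerate (`κ ≠ 0` constant) generators (Moncrief–Isenberg CMP 89 (1983); Friedrich–Rácz–Wald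
CMP 204 (1999), arXiv:gr-qc/9811021; Petersen–Rácz arXiv:1809.02580; Bustamante–Reiris arXiv:2008.11926;
smoothness: Minguzzi arXiv:1406.5919, Larsson arXiv:1406.5909) — nothing covers a non-compact horizon through
one visible point, degenerate generators, or a horizon that is merely Lipschitz where `γ` exits.
Sources: the above; Hawking–Ellis 1973 §5.8 (Misner/Taub–NUT models); doi:10.1103/PhysRevD.46.603.
Size: XL / open (the crux's heart). -/
def Sig.stub_symmetryOfRegularExit : Prop :=
  ∀ (X : Type) [TopologicalSpace X] [ChartedSpace E3 X] [IsManifold (𝓡 3) ∞ X] [T2Space X]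
    [SecondCountableTopology X] [ConnectedSpace X], ∀ D ∈ admissibleVacuumData X, ∀ 𝒟 :
    VacuumCauchyDevelopment D, 𝒟.IsMaximal → ∀ [𝒟.metric.HasLeviCivita], ∀ (γ : ℝ → 𝒟.carrier) (dom
    : Set ℝ), VisibleRay 𝒟 γ dom → ExitsRegularly 𝒟 γ dom → EndsBySymmetry 𝒟 γ dom

/-- **STUB 1 — A VISIBLE INCOMPLETE RAY EXISTS** — BY NAME the route's support item `VisibleIncompleteRay`
(stmt-FinalStateConjecture-10213, open, L): a maximal vacuum Cauchy development of an admissible datum with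
incomplete `𝓘⁺` (sojourn form) contains a visible future-incomplete null ray.  The sojourn negation yields
future-incomplete normalised rays from arbitrarily far out
(`Theorems.exists_normalisedNullRay_of_not_hasCompleteNullInfinity`, landed); their points are made visible
by asymptotically flat EXTERIOR STABILITY (complete outgoing cones from large spheres: Klainerman–Nicolò 2003;
Shen arXiv:2211.15230), which is the content not yet in the tree.  Why it might fail (as a lemma, not as
mathematics): the sojourn-incomplete rays might all dive into a black hole before becoming visible unless the
exterior region is controlled uniformly far out.  Sources: Christodoulou1999 (pp. A26–A27), KlainermanNicolo2003,
arXiv:2211.15230, HawkingEllis1973 §9.2. -/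
abbrev Sig.stub_visibleIncompleteRay : Prop :=
  VisibleIncompleteRay

/-! ## §2 The registered stubs (the ONLY `sorry`s of this file) -/

/-- Registered stub 1 (L): a visible future-incomplete null ray exists — the support item `VisibleIncompleteRay`
by name.  See `Sig.stub_visibleIncompleteRay`. -/
theorem stub_visibleIncompleteRay : Sig.stub_visibleIncompleteRay := by
  sorry

/-- Registered stub 2 (XL): regular exit of bounded curvature.  See `Sig.stub_regularExitOfBoundedCurvature`. -/
theorem stub_regularExitOfBoundedCurvature : Sig.stub_regularExitOfBoundedCurvature := by
  sorry

/-- Registered stub 3 (XL, hardest, the crux's heart): symmetry of regular exits.  See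
`Sig.stub_symmetryOfRegularExit`. -/
theorem stub_symmetryOfRegularExit : Sig.stub_symmetryOfRegularExit := by
  sorry

/-! ## §3 The composition — the crux BY NAME from the three stubs (real proof, no `sorry`) -/

/-- **Skeleton theorem.**  `VisibleIncompleteRay`, regular exit of bounded curvature and symmetry of regular
exits imply the crux `Theses.CurvatureOrSymmetry.NoFourthExit` BY NAME.  Fix an admissible `D`, an MGHD `𝒟`
with incomplete `𝓘⁺` and the Levi-Civita instance.  Either some visible future-incomplete null ray of `𝒟`
ends by curvature — then it is the witness, alternative (a); or none does — then stub 1 supplies a visible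
incomplete ray, stub 2 turns "none ends by curvature" into a visible incomplete ray `γ` which exits regularly,
and stub 3 makes `γ` end by symmetry, alternative (c).  Every hand-over is definitional (`VisibleRay`,
`EndsByCurvature`, `EndsBySymmetry` are token-identical copies of the crux's conjuncts). -/
theorem NoFourthExit_of :
    Sig.stub_visibleIncompleteRay → Sig.stub_regularExitOfBoundedCurvature →
      Sig.stub_symmetryOfRegularExit → NoFourthExit := by
  intro hV hR hS X _ _ _ _ _ _ D hD 𝒟 hmax hinc _
  by_cases hcurv : ∃ (γ : ℝ → 𝒟.carrier) (dom : Set ℝ), VisibleRay 𝒟 γ dom ∧ EndsByCurvature 𝒟 γ dom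
  · obtain ⟨γ, dom, hγ, ha⟩ := hcurv
    exact ⟨γ, dom, hγ, Or.inl ha⟩
  · have hbdd : ∀ (γ : ℝ → 𝒟.carrier) (dom : Set ℝ), VisibleRay 𝒟 γ dom → ¬ EndsByCurvature 𝒟 γ dom :=
      fun γ dom hγ ha ↦ hcurv ⟨γ, dom, hγ, ha⟩
    obtain ⟨γ₁, dom₁, hγ₁⟩ := hV X D hD 𝒟 hmax hinc
    obtain ⟨γ, dom, hγ, hreg⟩ := hR X D hD 𝒟 hmax ⟨γ₁, dom₁, hγ₁⟩ hbdd
    exact ⟨γ, dom, hγ, Or.inr (hS X D hD 𝒟 hmax γ dom hγ hreg)⟩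

/-- The crux by name, closed modulo the three registered stubs (its axiom closure contains `sorryAx` through
the stubs only; `NoFourthExit_of` itself is sorry-free). -/
theorem noFourthExit_of_stubs : NoFourthExit :=
  NoFourthExit_of stub_visibleIncompleteRay stub_regularExitOfBoundedCurvature stub_symmetryOfRegularExit

end Summit.FinalStateConjecture.FinalStateConjecture.Cruxes.NoFourthExit.Birth

end
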